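import Literature.MathematicalPhysics.QuantumFieldTheory.Balaban1983to89.B8LeafSocketsB9
import Literature.MathematicalPhysics.QuantumFieldTheory.Balaban1983to89.B9

/-!
# `Balaban1983to89.B9SupplySockB9P3ZdLetters` — [Balaban1985BackgroundPropagators] THEOREM 3.3 AT THE `ℤᵈ × 𝔸` CARRIER OF THE
# [Balaban1985RegularSpaces] LEAF `B8LeafModelZd3.zdGF3`: the OPERATOR LETTERS of [4] Sect. A (`G(U₀)`, `Δ′(U₀)`, `D R(U₀) D*`,
# `Σ_j (Lʲη)⁻²Q_j*Λ_jQ_j`), the NORM DICTIONARY to an abstract [B9] frame (`B9.Geometry` ∕ `Backgrounds` ∕ `KernelFamily`), and the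
# BINDERS OF PRINTED SHAPE under which `B9.Thm33Printed` supplies the in-edge b9 socket `B8LeafModelZd3.SockB9P3` (companion theorem
# file `B9SupplySockB9P3Zd`)

statement-level skeleton of published theorems with citation tags; proofs where landed; nothing here is a claim about the
Yang–Mills mass gap

PDF held: `paper:balaban1985-cmp99-background-propagators` ([4] = B9; journal page = PDF page + 388): pp. 392–399 ((3.10), (3.16),
(3.20)–(3.27), (3.35), (3.41), (3.47), Thm 3.3), p. 404 (3.69); `paper:balaban1985-cmp99-regular-spaces-gauge-fixing` (B8; journal page =
PDF page + 74): p. 86 (1.55)–(1.59), p. 87 Prop. 3, p. 99 (1.136).  Read by this seat on the held text layers (2026-08-26).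

WHY THIS FILE (cell `pub-ymgap`, seat `pub-ymgap-dag-n06-b` g4, junction J-N06→N05, dag-lead REACTIVATE №9; count-neutral).  The N05 knit
(`B8LeafKnitZd3`, seat dag-n05-a) reads its in-edge b9 as ONE target «`∀ m ≤ k, SockB9P3 L B₀ B₀β cP β len η m Ω Λs Λb`»
(`B8LeafSocketsB9`): B8 (1.59), the five weighted a-priori bounds for a Landau-gauge `A′` at a CURVED unitary background `U₀` on `ℤᵈ`.
Print (B8 p. 86, verbatim): *«They imply finally A = G(U₀)J − G(U₀)D^{η*}_{U₀}D_{U₀}H(U₀)B₁ + H(U₀)B₁ = G(U₀)J + G(U₀)Σ_jQ*_jΛ_j(Lʲη)⁻³B₁, (1.58)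
where the operator G(U₀) was introduced and investigated in [4] … Theorem 3.3 of [4] implies the bounds (1.59)»*; [4] p. 395 (3.26)–(3.27):
*«Δ_a = Δ + DRD* + Q*aQ … G(U) = G = (Δ_a↾Ω₀)⁻¹»*, p. 392 (3.10): *«Δ = D*D + Δ′ … the operator Δ′ will be a bounded, small operator, which
will be treated as a small perturbation of D*D»*, p. 399 Theorem 3.3: *«the operator G(U) (a = 1) satisfies the inequalities (3.42)–(3.47), with
G′(U) replaced by G(U) and λ replaced by a function J defined at bonds»*.  The tree holds the whole chain ABSTRACTLY (`B8FromB9`: the (1.58)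
identity `b8_158_identity`, the Δ′-transfer G-IF-01 `b8_159_transfer` over normed spaces, the edge `opBound_of_B9glob` asking for a norm
DICTIONARY `hT`∕`hF`) and the [B9] frame as abstract carriers (`B9.Geometry`, `B9.Backgrounds`, `B9.KernelFamily`, `B9.Thm33Printed`); dag-n19-b's
census J-N06-N05 (v1.1, 2026-08-26) located the remaining piece: THE INSTANCE ∕ DICTIONARY AT THE CONCRETE `ℤᵈ` CARRIER.  This file types it in
the pattern of the Stage-3′(Y) pin (`B9PinCarriersKLevelV1.OperatorLayerY`: the operator layer is an explicit PARAMETER RECORD — nothing of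
[4] Sect. A's operators is constructed here, that is N06's object-bound (the inverses exist by [4] Thm 3.11)).

WHAT IS DECLARED (definitions with bodies; NO theorem of the papers is asserted; every binder is a `Prop` the consumer takes as a hypothesis).
* §1 `OpsZd` — the four operator LETTERS at one member: `Gop U₀` = G(U₀) of (3.27) acting on bond fields, `Dp U₀` = Δ′(U₀) of (3.10), `DRDs U₀` =
  D R(U₀) D* of (3.26) (R = the projection (3.20)–(3.25)), `QQ U₀` = Q*aQ of (3.16) at a = 1 in B8's normalisation Σ_j(Lʲη)⁻²Q*_jΛ_jQ_j ((1.58));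
  `deltaAOf` = Δ_a(U₀)A := D*_{U₀}D_{U₀}A + Δ′A + DRD*A + Q*aQ A ((3.26) with (3.10); `B8Eq155JBound.Jcur` = D*D); `OnE` = «A is a bond field on
  the E_j = the sides of the plaquettes touching Ω_j, j ≤ m, zero elsewhere, with finite |A|₍₋₁₎» (the space E of `B8FromB9` §B; dag-n05-a's
  support reading G-B8-16 and r05's `B8ScaledSupNorm.Bdd`).
* §2 over an ABSTRACT [B9] frame `geo : I → B9.Geometry`, `bg : I → B9.Backgrounds`, `GA : ∀ i, B9.KernelFamily (geo i) (bg i)` with a MEMBER MAP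
  `mem M i m : I` (block parameter `M` of [4], datum `i : B8LeafModelZd.ZdIdx d L`, truncation level `m` — B8 p. 88 «the same conditions for
  k − 1»), embeddings `ιCfg` (unitary backgrounds ↦ `(bg _).Cfg`) and `ιLoc` (bond fields ↦ `(geo _).Loc`):
  `DictGlob` — THE NORM DICTIONARY (`B8FromB9.opBound_of_B9glob`'s `hT`∕`hF` shapes): `(geo _).M = M`, `wNorm (−3) (ι J) = |J|₍₋₃₎`
  (`bondNorm`), and the γ = −3 global entries n = 0, 1, 3 of (3.47) for `GA` read as `|G(U₀)J|₍₋₁₎` (over the E_j), `|∇^η_{U₀}G(U₀)J|₍₋₂₎`,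
  `|Δ^η_{U₀}G(U₀)J|₍₋₃₎` (componentwise covariant Laplacian `B8Eq138LandauZd.covLap`, dag-n05-a's reading (iv) of B8 (1.39)∕(1.59));
  `Prop6Feed` — B8 Prop. 6 (1.136) in [4]'s shape (`B8FromB9` §D): `U₀ ∈ 𝔄_m({Ω_j}, α₀)` (`B8Ineq132.InAk`) with `Mα₀ ≤ c₆` ⇒ (3.35) with α₀ read as
  `K₆α₀`; `InvOnSupp` — (3.27) in the used form: for regular `U₀` (M ≥ M₃, Mα₀ ≤ a₃ — Thm 3.11's regime) G(U₀)∘Δ_a(U₀) = id on `OnE` fields;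
  `CurvSmall` — (3.69) p. 404 at U′ = 1 in the weighted norms (3.41) (`B8FromB9` (Q3)): `(Lʲη)³|Δ′(U₀)A(b)| ≤ c₆₉·M·α₀·|A|₍₋₁₎` on Ω_j;
  `LandauKills` — (3.20)–(3.21) with B8 (1.42): the Landau condition of record (`B8Eq138LandauZd.IsLandau138`, multiplier form; its
  identification with print's `R(U₀)D*A = 0` is `B8Eq138Multiplier`, modulo the (3.25)-inverses) kills the DRD* term of Δ_aA;
  `AvgBound` — (3.16) with B8 (1.56)∕(1.58): `(Lʲη)³|(Q*aQ A)(b)| ≤ q·|B₁(A)|`, `|B₁|` the socket's `wsup 1 (linCovIter …)`;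
  `HolderGlob` — B8 Prop. 3 p. 87 «B₀(β₀) … the corresponding norms of the operators G(U₀)» with [4] (3.43) ⇒ global by Lemma 2.1: the local
  Hölder block `B9.Ineq343_345 … Bβ …` bounds the weighted β-Hölder norm of ∇_{U₀}G(U₀)J by `C_H·Bβ(β)·|J|₍₋₃₎`.

HONEST SCOPE.  (i) LETTERS, NOT OBJECTS: `OpsZd` is a parameter; the binders are exactly what B8 p. 86 uses of [4]; proving them at this
carrier = constructing [4] Sect. A ((3.10)–(3.27), Thm 3.11) there — N06's object-bound, NOT here.  (ii) iSup-junk guards: every binder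
quantifies over `OnE` fields (bounded, supported on the E_j) and is POINTWISE in print's form, so the true operators can satisfy it
(r05's `msup` is a real `iSup`).  (iii) Readings inherited from the consumer: «on Ω_j» for bond fields A = the E_j (G-B8-16); Δ^η_{U₀} on
vector fields componentwise; `Reg335 := …` is the member's own field (its body is the family's, e.g. `B9Eq335RegularityClasses.Reg335`).
(iv) Count-neutral; N05∕N06 NOT discharged; nothing continuum ∕ ℝ⁴ ∕ OS ∕ mass-gap ∕ Clay.  Unit `pub-ymgap-dag-n06-b` (g4), 2026-08-26.
-/

noncomputable section

open NormedSpace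

namespace Literature.MathematicalPhysics.QuantumFieldTheory.Balaban1983to89.B9SupplySockB9P3ZdLetters

open B7Prop2Explicit (unitaryUnits)
open B7Prop4GeneralLevels (linCovIter)
open B8Ineq132 (covDerivFwd InAk BondTouches)
open B8Eq140Level (SideTouches)
open B8Eq146AExpansion (iEta)
open B8Eq155JBound (Jcur wsup)
open B8ScaledSupNorm (bondNorm msup Bdd)
open B8Eq138LandauZd (IsLandau138 covLap)
open B8LeafModelZd (ZdIdx)
open B9Eq340HolderZd (hquot AdmPair)

-- `Site` alone could resolve to the torus sites of `Setup.lean`; re-export the `ℤ^d` sites of `B7Prop1Explicit`.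
export B7Prop1Explicit (Site)

variable {d : ℕ}

/-! ## §1 The operator letters of [4] Sect. A at one member, Δ_a(U₀), and the field class E -/

/-- **THE OPERATOR LETTERS OF [4] SECT. A AT ONE MEMBER** (block parameter, domain sequence, truncation level fixed), as total functions on
bond fields `A : Site d → Fin d → 𝔸` for each background `U₀`: `Gop U₀` = the propagator G(U₀) = (Δ_a↾Ω₀)⁻¹ (3.27); `Dp U₀` = the curvature
part Δ′(U₀) of the Hessian Δ = D*D + Δ′ (3.10); `DRDs U₀` = D R(U₀) D*, R(U₀) the projection of (3.20)–(3.25); `QQ U₀` = Q*aQ of (3.16) at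
a = 1, in B8's normalisation Σ_j Q*_jΛ_j(Lʲη)⁻²Q_j ((1.58)).  A PARAMETER RECORD — nothing is constructed or asserted (the pattern of
`B9PinCarriersKLevelV1.OperatorLayerY`). [cite: Balaban1985BackgroundPropagators, (3.10) p.392, (3.16) p.393, (3.20)–(3.27) pp.394–395] -/
structure OpsZd (d : ℕ) (𝔸 : Type*) [Monoid 𝔸] where
  Gop : (Site d → Fin d → 𝔸ˣ) → (Site d → Fin d → 𝔸) → Site d → Fin d → 𝔸
  Dp : (Site d → Fin d → 𝔸ˣ) → (Site d → Fin d → 𝔸) → Site d → Fin d → 𝔸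
  DRDs : (Site d → Fin d → 𝔸ˣ) → (Site d → Fin d → 𝔸) → Site d → Fin d → 𝔸
  QQ : (Site d → Fin d → 𝔸ˣ) → (Site d → Fin d → 𝔸) → Site d → Fin d → 𝔸

variable {𝔸 : Type*} [CStarAlgebra 𝔸]

/-- **Δ_a(U₀)A = D*_{U₀}D_{U₀}A + Δ′(U₀)A + D R(U₀) D*A + Q*aQ A** — (3.26) «Δ_a = Δ + DRD* + Q*aQ» with (3.10) «Δ = D*D + Δ′», the
D*D term being B8's current `J = D^{η*}_{U₀}D^η_{U₀}A` (`B8Eq155JBound.Jcur`, (1.55)) and the other three the letters of `ops`.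
[cite: Balaban1985BackgroundPropagators, (3.26) p.395, (3.10) p.392; Balaban1985RegularSpaces, (1.55), (1.58) p.86] -/
def deltaAOf (η : ℝ) (ops : OpsZd d 𝔸) (U₀ : Site d → Fin d → 𝔸ˣ) (A : Site d → Fin d → 𝔸) : Site d → Fin d → 𝔸 :=
  fun x μ => Jcur η U₀ A μ x + ops.Dp U₀ A x μ + ops.DRDs U₀ A x μ + ops.QQ U₀ A x μ

/-- **The field class E** (`B8FromB9` §B: «fields on Ω, norm |·|₍₋₁₎») on the `ℤᵈ` carrier with `m` levels: `A` vanishes off the sides of the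
plaquettes touching some `Ω_j`, `j ≤ m` (dag-n05-a's reading of print's «on Ω_j», G-B8-16) and its weighted family `(Lʲη)·|A(b)|` there is
bounded (r05's `Bdd`: the real supremum `|A|₍₋₁₎` is attained). [cite: Balaban1985BackgroundPropagators, (3.41) p.397; Balaban1985RegularSpaces, p.77 (bond convention), (1.41) p.83] -/
def OnE (L m : ℕ) (η : ℝ) (Ω : ℕ → Set (Site d)) (A : Site d → Fin d → 𝔸) : Prop :=
  (∀ (y : Site d) (τ : Fin d), (∀ j, j ≤ m → ¬ SideTouches (Ω j) y τ) → A y τ = 0) ∧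
    Bdd L m η (-(1 : ℝ)) (fun j (b : Site d × Fin d) => SideTouches (Ω j) b.1 b.2) (fun b => A b.1 b.2)

/-! ## §2 The abstract [B9] frame, the norm dictionary, and the binders of printed shape -/

section Frame

variable {I : Type} (geo : I → B9.Geometry) (bg : I → B9.Backgrounds) (GA : ∀ i, B9.KernelFamily (geo i) (bg i))
variable (L : ℕ) (mem : ℝ → ZdIdx d L → ℕ → I)
variable (ιCfg : ∀ (M : ℝ) (i : ZdIdx d L) (m : ℕ) (U₀ : Site d → Fin d → 𝔸ˣ),
  (∀ x κ, U₀ x κ ∈ unitaryUnits 𝔸) → (bg (mem M i m)).Cfg)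
variable (ιLoc : ∀ (M : ℝ) (i : ZdIdx d L) (m : ℕ), (Site d → Fin d → 𝔸) → (geo (mem M i m)).Loc)

/-- **THE NORM DICTIONARY** (the `hT`∕`hF` shapes of `B8FromB9.opBound_of_B9glob`, at every member `(M, i, m)`): the member's block parameter IS
`M`; the frame's weighted norm (3.41) at γ = −3 of an embedded bond field is `|J|₍₋₃₎` (`bondNorm`, bonds with an end-point in Ω_j); and the
γ = −3 global entries (3.47) of the kernel family `GA` («(3.42)–(3.47) with G′(U) replaced by G(U) and λ replaced by a function J defined at
bonds», Thm 3.3) are, for n = 0, 1, 3: `|G(U₀)J|₍₋₁₎` over the E_j, `|∇^η_{U₀}G(U₀)J|₍₋₂₎` (all components of the forward covariant gradient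
(1.1)), `|Δ^η_{U₀}G(U₀)J|₍₋₃₎` (componentwise covariant Laplacian `covLap`) — the three left-hand sides of B8 (1.59) at `A = G(U₀)J`.  (Entry
n = 2, `G∇*`, is not read by (1.59) and not pinned.) [cite: Balaban1985BackgroundPropagators, (3.41) p.397, (3.47) p.398, Thm 3.3 p.399; Balaban1985RegularSpaces, (1.59) p.86] -/
def DictGlob (ops : ℝ → ZdIdx d L → ℕ → OpsZd d 𝔸) : Prop :=
  ∀ (M : ℝ) (i : ZdIdx d L) (m : ℕ), (geo (mem M i m)).M = M ∧
    ∀ (U₀ : Site d → Fin d → 𝔸ˣ) (hU₀ : ∀ x κ, U₀ x κ ∈ unitaryUnits 𝔸) (J : Site d → Fin d → 𝔸),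
      (geo (mem M i m)).wNorm (-3) (ιLoc M i m J) = bondNorm L m i.η (-(3 : ℝ)) i.Ω J ∧
      (GA (mem M i m)).glob 0 (ιCfg M i m U₀ hU₀) (ιLoc M i m J) (-3) =
        msup L m i.η (-(1 : ℝ)) (fun j (b : Site d × Fin d) => SideTouches (i.Ω j) b.1 b.2)
          (fun b => (ops M i m).Gop U₀ J b.1 b.2) ∧
      (GA (mem M i m)).glob 1 (ιCfg M i m U₀ hU₀) (ιLoc M i m J) (-3) =
        msup L m i.η (-(2 : ℝ)) (fun j (t : Fin d × Fin d × Site d) => SideTouches (i.Ω j) t.2.2 t.2.1)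
          (fun t => covDerivFwd i.η U₀ t.1 (fun z => (ops M i m).Gop U₀ J z t.2.1) t.2.2) ∧
      (GA (mem M i m)).glob 3 (ιCfg M i m U₀ hU₀) (ιLoc M i m J) (-3) =
        bondNorm L m i.η (-(3 : ℝ)) i.Ω (fun x μ => covLap i.η U₀ (fun z => (ops M i m).Gop U₀ J z μ) x)

/-- **B8 PROPOSITION 6 (1.136) IN [4]'s SHAPE (3.35)** as a binder at the carrier (`B8FromB9` §D `prop6_in_B9_shape`∕`smallness_conversion`):
«for U₀ ∈ 𝔄_k … on □_j there exists a gauge with Lʲη|A|, (Lʲη)²|∇^ηA| < 7dL²B₁Mα₀» — i.e. the member's regularity class (3.35) with the O(1)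
constant `c35` holds at [4]'s α₀ READ AS `K₆·α₀` whenever `U₀ ∈ 𝔄_m({Ω_j}, α₀)` (`B8Ineq132.InAk`), `Mα₀ ≤ c₆` and the block parameter is in
range `M ≥ M₃` (B8 p. 83: «this condition [(3.35)] is a consequence of the first one in (1.33), so eventually we will drop it»; B8 p. 98 «we take a
size of □ equal to MLʲη»). [cite: Balaban1985RegularSpaces, Prop. 6 (1.136) p.99, p.83 (after (1.35)); Balaban1985BackgroundPropagators, (3.35) p.396] -/
def Prop6Feed (c35 M₃ c₆ K₆ : ℝ) : Prop :=
  ∀ (M : ℝ) (i : ZdIdx d L) (m : ℕ), M₃ ≤ M →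
    ∀ (α₀ : ℝ) (U₀ : Site d → Fin d → 𝔸ˣ) (hU₀ : ∀ x κ, U₀ x κ ∈ unitaryUnits 𝔸),
      0 < α₀ → M * α₀ ≤ c₆ → InAk L m i.η α₀ i.Ω U₀ → (bg (mem M i m)).Reg335 c35 (K₆ * α₀) (ιCfg M i m U₀ hU₀)

/-- **(3.27) IN THE FORM B8 (1.58) USES IT**: «G(U) = G = (Δ_a↾Ω₀)⁻¹» — for a regular background (the member's (3.35) class at α₀, with
M ≥ M₃ and Mα₀ ≤ a₃: the «M sufficiently large and α₀ sufficiently small» of Theorem 3.11, under which Δ_a is positive definite) the letter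
G(U₀) is a LEFT INVERSE of Δ_a(U₀) (`deltaAOf`) on the field class E (`OnE`: Dirichlet reading — fields supported on the E_j).
[cite: Balaban1985BackgroundPropagators, (3.27) p.395, Thm 3.11 p.416; Balaban1985RegularSpaces, (1.58) p.86] -/
def InvOnSupp (ops : ℝ → ZdIdx d L → ℕ → OpsZd d 𝔸) (c35 M₃ a₃ : ℝ) : Prop :=
  ∀ (M : ℝ) (i : ZdIdx d L) (m : ℕ), M₃ ≤ M →
    ∀ (α₀ : ℝ) (U₀ : Site d → Fin d → 𝔸ˣ) (hU₀ : ∀ x κ, U₀ x κ ∈ unitaryUnits 𝔸), 0 < α₀ → M * α₀ ≤ a₃ →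
      (bg (mem M i m)).Reg335 c35 α₀ (ιCfg M i m U₀ hU₀) →
      ∀ A : Site d → Fin d → 𝔸, OnE L m i.η i.Ω A → (ops M i m).Gop U₀ (deltaAOf i.η (ops M i m) U₀ A) = A

/-- **(3.69) AT U′ = 1 IN THE WEIGHTED NORMS (3.41)** («the operator Δ′ will be a bounded, small operator», p. 392; «|(Δ′(U′U)A′)(b)| ≤
O(1)(Mα₀ + α₁)(Lʲη)⁻²|A′|, b ∈ Ω_j (3.69) the supremum … over bonds belonging to one of the plaquettes containing the bond b», p. 404; read with
(3.41) as `B8FromB9`'s (Q3) «|Δ′A′|₍₋₃₎ ≤ κ|A′|₍₋₁₎, κ = O(1)·L·Mα₀», `weighted_369_pointwise`): POINTWISE on the bonds of Ω_j, j ≤ m, for a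
regular background in Theorem 3.11's regime (M ≥ M₃, Mα₀ ≤ a₃, the member's (3.35) class) and a field of E,
`(Lʲη)³|(Δ′(U₀)A)(b)| ≤ c₆₉·M·α₀·|A|₍₋₁₎` (the bonds of the plaquettes containing a bond of Ω_j are sides touching Ω_j, so print's supremum is
below `(Lʲη)⁻¹|A|₍₋₁₎` over the E_j). [cite: Balaban1985BackgroundPropagators, (3.69) p.404, (3.10) p.392, (3.41) p.397] -/
def CurvSmall (ops : ℝ → ZdIdx d L → ℕ → OpsZd d 𝔸) (c35 M₃ a₃ c69 : ℝ) : Prop :=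
  ∀ (M : ℝ) (i : ZdIdx d L) (m : ℕ), M₃ ≤ M →
    ∀ (α₀ : ℝ) (U₀ : Site d → Fin d → 𝔸ˣ) (hU₀ : ∀ x κ, U₀ x κ ∈ unitaryUnits 𝔸), 0 < α₀ → M * α₀ ≤ a₃ →
      (bg (mem M i m)).Reg335 c35 α₀ (ιCfg M i m U₀ hU₀) →
      ∀ A : Site d → Fin d → 𝔸, OnE L m i.η i.Ω A → ∀ j, j ≤ m → ∀ (x : Site d) (μ : Fin d), BondTouches (i.Ω j) x μ →
        ((L : ℝ) ^ j * i.η) ^ 3 * ‖(ops M i m).Dp U₀ A x μ‖ ≤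
          c69 * M * α₀ * msup L m i.η (-(1 : ℝ)) (fun j (b : Site d × Fin d) => SideTouches (i.Ω j) b.1 b.2) (fun b => A b.1 b.2)

/-- **THE LANDAU CONDITION KILLS THE DRD\* TERM** ((3.20)–(3.21): «R = R(U) is an orthogonal projection … onto the subspace R = Δ^η_U N(Q′)»;
B8 (1.42)∕(1.58): for `R(U₀)D^{η*}_{U₀}A = 0` the equation for A has no DRD* term): for a regular background (Theorem 3.11's regime, where the
(3.25)-inverses defining R exist) and a field of E satisfying the Landau condition OF RECORD — dag-n05-a's multiplier form
`B8Eq138LandauZd.IsLandau138`, whose identification with print's projection form is `B8Eq138Multiplier` (modulo exactly those inverses) —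
`D R(U₀) D* A = 0`. [cite: Balaban1985BackgroundPropagators, (3.20)–(3.21) p.394, (3.25) p.394; Balaban1985RegularSpaces, (1.42) p.83, (1.58) p.86] -/
def LandauKills (ops : ℝ → ZdIdx d L → ℕ → OpsZd d 𝔸) (c35 M₃ a₃ : ℝ) : Prop :=
  ∀ (M : ℝ) (i : ZdIdx d L) (m : ℕ), M₃ ≤ M →
    ∀ (α₀ : ℝ) (U₀ : Site d → Fin d → 𝔸ˣ) (hU₀ : ∀ x κ, U₀ x κ ∈ unitaryUnits 𝔸), 0 < α₀ → M * α₀ ≤ a₃ →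
      (bg (mem M i m)).Reg335 c35 α₀ (ιCfg M i m U₀ hU₀) →
      ∀ A : Site d → Fin d → 𝔸, OnE L m i.η i.Ω A → IsLandau138 L m i.η (i.Ω 0) (i.Λs m) U₀ A →
        ∀ (x : Site d) (μ : Fin d), (ops M i m).DRDs U₀ A x μ = 0

/-- **THE AVERAGING TERM IS BOUNDED BY |B₁|** ((3.16) «⟨A, Q*aQA⟩ = Σ_j a Σ_{b∈Λ_j}(Lʲη)^{d−2}|(Q_j(U)A)(b)|²»; B8 (1.56)∕(1.58): «LʲηQ_jA = B₁ …
A = G(U₀)J + G(U₀)Σ_jQ*_jΛ_j(Lʲη)⁻³B₁», so the (1.58) source has weighted norm ≤ |J|₍₋₃₎ + q|B₁| with «q = sup_j‖Q_j*‖ a number depending on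
d, L only; the weights (Lʲη)⁻³ are exactly absorbed by the norm |·|₍₋₃₎» — `B8FromB9.norm_source_le`): POINTWISE on the bonds of Ω_j, for a
unitary background and a field of E, `(Lʲη)³|(Σ_j(Lʲη)⁻²Q*_jΛ_jQ_jA)(b)| ≤ q·|B₁(A)|`, `|B₁(A)|` the consumer's
`wsup 1 (linCovIter L U₀ (iηA) …)` over the constraint bonds `Λb m`. [cite: Balaban1985BackgroundPropagators, (3.16) p.393; Balaban1985RegularSpaces, (1.56), (1.58) p.86] -/
def AvgBound (ops : ℝ → ZdIdx d L → ℕ → OpsZd d 𝔸) (q : ℝ) : Prop :=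
  ∀ (M : ℝ) (i : ZdIdx d L) (m : ℕ) (U₀ : Site d → Fin d → 𝔸ˣ), (∀ x κ, U₀ x κ ∈ unitaryUnits 𝔸) →
    ∀ A : Site d → Fin d → 𝔸, OnE L m i.η i.Ω A → ∀ j, j ≤ m → ∀ (x : Site d) (μ : Fin d), BondTouches (i.Ω j) x μ →
      ((L : ℝ) ^ j * i.η) ^ 3 * ‖(ops M i m).QQ U₀ A x μ‖ ≤
        q * wsup 1 (fun p : {p : ℕ × (Site d × Fin d) // p.1 ≤ m ∧ p.2 ∈ i.Λb m p.1} =>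
              linCovIter L U₀ (iEta i.η A) p.1.1 p.1.2.1 p.1.2.2)

/-- **THE GLOBAL WEIGHTED HÖLDER NORM OF ∇_{U₀}G(U₀)** (B8 Prop. 3 p. 87: «B₀, B₀(β₀) are the corresponding norms of the operators G(U₀),
H(U₀), and depend on d and L only, B₀(β₀) on β₀ also»; [4] p. 398: the local Hölder bounds (3.43) «‖ζ∇_UG(U)λ‖_β ≤ B₀(β₀)(Lʲη)^{1−β}(‖ζ‖_β + |ζ|)
e^{−δ₀d(y,y′)}|λ|» and «the global inequalities (3.47) are consequences of the local ones (3.42) and Lemma 2.1»): whenever the member's LOCAL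
Hölder block `B9.Ineq343_345 … Bβ …` holds at `U₀`, the weighted (3.40)-Hölder functional of the consumer (`B9Eq340HolderZd.hquot` over the
admissible pairs starting in Ω_j, exponent `β`, length function `len` — the fifth line of (1.59)) of ∇^η_{U₀}G(U₀)J is at most
`C_H·Bβ(β)·|J|₍₋₃₎` (print: 0 ≤ β < 1). [cite: Balaban1985RegularSpaces, Prop. 3 p.87, (1.59) p.86; Balaban1985BackgroundPropagators, (3.43), (3.47) p.398, (3.40) p.397] -/
def HolderGlob (ops : ℝ → ZdIdx d L → ℕ → OpsZd d 𝔸) (β : ℝ) (len : Site d → ℝ) (CH : ℝ) : Prop :=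
  ∀ (M : ℝ) (i : ZdIdx d L) (m : ℕ) (Bβ Bε : ℝ → ℝ) (Bεβ : ℝ → ℝ → ℝ) (δ₀ : ℝ)
    (U₀ : Site d → Fin d → 𝔸ˣ) (hU₀ : ∀ x κ, U₀ x κ ∈ unitaryUnits 𝔸),
    B9.Ineq343_345 (GA (mem M i m)) Bβ Bε Bεβ δ₀ (ιCfg M i m U₀ hU₀) →
    ∀ J : Site d → Fin d → 𝔸,
      msup L m i.η (-(2 + β)) (fun j (q : Fin d × Fin d × (Site d × Site d)) => q.2.2 ∈ AdmPair i.η len ∧ q.2.2.1 ∈ i.Ω j)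
          (fun q => hquot i.η β len U₀ (covDerivFwd i.η U₀ q.1 (fun z => (ops M i m).Gop U₀ J z q.2.1)) q.2.2)
        ≤ CH * Bβ β * bondNorm L m i.η (-(3 : ℝ)) i.Ω J

end Frame

end Literature.MathematicalPhysics.QuantumFieldTheory.Balaban1983to89.B9SupplySockB9P3ZdLetters

end
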